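import Summits.NavierStokesRegularity.FluidComputer.PalasekTowerGermHostSliceDoorAt
import Summits.NavierStokesRegularity.FluidComputer.PalasekTowerGermHostFadeSize

/-!
# The germ host at arbitrary rates — THE EXPLICIT SLOT `LineGermDataAt R (U, ρ, σ₀, ε, c₄)`, shorter fades,
# the size of the faded force, its stage and its slice-run door (layer L4b, first half, of the door port)

Cell `ns-blowup`, seat `ns-blowup-ecbridge-3` (g8); GROUP C «BRIDGE SUPPORT» of the route
`PalasekTowerBreakdown` after the RE-BASE (rev 19; live crux `EpisodeBaseT := EpisodeBaseGAt TowerRates.tuned`,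
stmt-NavierStokesRegularity-20303). The `R`-generic twin of `PalasekTowerGermHostExplicit.lean` (g3) and of
`PalasekTowerGermHostFadeSize.lean` §1 (g6), on top of `PalasekTowerGermHostAt` / `…SliceDoorAt` (g8). The
point of the explicit slot is that the fade length `ε` is DATA and can be SHORTENED (`restrictFade`) — what
the free-run door needs (force off on the second half of the window). LABEL: E–C typing (KERNEL
construction: one `Prop` structure with parameters and one definition with body — the explicit schedule at
`R`; everything proved). WHAT THIS IS NOT: not Navier–Stokes evidence — a prescribed host and bookkeeping; no
run of the first window is exhibited; `EpisodeBaseGAt R` only as the conclusion of a conditional.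

* §1 `LineGermDataAt R U ρ σ₀ ε c₄` (readouts of `U` at `R`, line anchor at width `σ₀`, residual bound
  `≤ c₄ Y₀(R)` on `[1, 1 + ε]`, `0 < ε ≤ w₀(R)`, `0 < c₄ ≤ 1`); `LevelZeroDataAt.lineGermDataAt` (the abstract
  slot fills it at `σ₀ = h.width`, `ε = h.fadeLen`); `restrictFade`; `force_facts` (Clay class, confinement,
  `= residual` for `t ≤ 1`, `f(1) = 0`); `force_eq_zero_of_ge` (zero from `τ₁(R)` on); `norm_force_le`;
  **`exists_norm_lineForce_le_mul`** (`‖lineForce U σ₀ ε‖ ≤ ε L` on `[1, 1 + ε]`, one `L` for all `ε ≤ ε₀`);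
* §2 the explicit schedule `d.schedule hR` (`Schedule.ofBoxAt`), rigid / quiet / pins, the level-`0` **`stage`**,
  `stage_slice` (`u(τ₀) = U`), and **`episodeBaseGAt_of_sliceRun`**: ONE classical finite-energy run on
  `[1, τ₁(R)]` under `lineForce U σ₀ ε` from `v 1 = U`, below `(5/3)Y₁(R)`, with the three level-`1` floors at
  `τ₁(R)` in `B̄(0, ρ)` ⟹ `EpisodeBaseGAt R`.

References: S. Palasek, arXiv:2605.13827 §3.3–§4 [cite: Palasek2026ElementaryModel, §3.3]; H. Sohr, *The
Navier–Stokes Equations*, Birkhäuser 2001, Ch. V Thm. 1.5.1 [cite: Sohr2001, Ch. V Thm. 1.5.1];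
C. L. Fefferman, Clay problem description, (4)–(7) [cite: FeffermanClay2006, (4) (5) (6) (7)].
-/

noncomputable section

namespace Summit.NavierStokesRegularity.FluidComputer.PalasekTowerClayBridge.Germ

open Set Function Filter Topology InnerProductSpace Metric MeasureTheory
open scoped Topology ContDiff RealInnerProductSpace ENNReal

open Literature.Analysis.FluidPDE

/-! ## §1 The explicit slot at the rates `R` -/

/-- **EXPLICIT GERM DESIGN DATA AT THE RATES `R`** `(U, ρ, σ₀, ε, c₄)`: the level-`0` readouts of `U` at `R`,
the LINE ANCHOR at width `σ₀ > 0`, the RESIDUAL BOUND `≤ c₄ Y₀(R)` of the line germ on the fade window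
`[1, 1 + ε]` (`0 < ε ≤ w₀(R)`), and `0 < c₄ ≤ 1`. At `R = wide` this is `Germ.LineGermData`.
[cite: Palasek2026ElementaryModel, §3.3] -/
structure LineGermDataAt (R : TowerRates) (U : EuclideanSpace ℝ (Fin 3) → EuclideanSpace ℝ (Fin 3))
    (ρ σ₀ ε c₄ : ℝ) : Prop where
  /-- the profile is smooth -/
  smooth : ContDiff ℝ ∞ U
  /-- … supported in the closed ball of radius `ρ` -/
  support : tsupport U ⊆ closedBall 0 ρ
  /-- … and divergence free -/
  divFree : VectorCalculus.IsDivFree U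
  /-- speed ceiling `Y₀(R)` everywhere -/
  ceiling : ∀ x, ‖U x‖ ≤ R.Y 0
  /-- speed floor `Y₀(R)` attained in the ball -/
  floor : ∃ x, ‖x‖ ≤ ρ ∧ R.Y 0 ≤ ‖U x‖
  /-- strain floor `A₀(R)` attained in the ball -/
  strain : ∃ x, ‖x‖ ≤ ρ ∧ R.A 0 ≤ ‖fderiv ℝ U x‖
  /-- the level-`0` core loop at `R` -/
  core : ∃ (x : EuclideanSpace ℝ (Fin 3)) (γ : ℝ → EuclideanSpace ℝ (Fin 3)),
    ‖x‖ ≤ ρ ∧ ContDiff ℝ 1 γ ∧ γ 0 = γ 1 ∧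
      (∀ s ∈ Icc (0 : ℝ) 1, γ s ∈ closedBall x (1 / R.N 0)) ∧
      (∀ s ∈ Icc (0 : ℝ) 1, ‖deriv γ s‖ ≤ 8 * Real.pi / R.N 0) ∧
      R.N 0 ^ (R.β - 2) ≤ circulation U γ
  /-- the width of the anchored segment is positive -/
  width_pos : 0 < σ₀
  /-- the LINE ANCHOR at width `σ₀` -/
  line : ∀ σ : ℝ, -σ₀ < σ → σ < 0 → ∀ x, ‖U x + σ • accel 1 U x‖ < R.Y 0
  /-- the fade length is positive -/
  fade_pos : 0 < ε
  /-- … and at most the first growth window of `R` -/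
  fade_le : ε ≤ Host.wfirstAt R
  /-- the push constant is positive -/
  push_pos : 0 < c₄
  /-- … and at most `c₁ = 1` -/
  push_le : c₄ ≤ 1
  /-- the RESIDUAL BOUND of the line germ on the fade window -/
  window : ∀ t ∈ Icc (1 : ℝ) (1 + ε), ∀ x : EuclideanSpace ℝ (Fin 3),
    ‖germResid 1 U αhost (βhost σ₀) t x‖ ≤ c₄ * R.Y 0

/-- **A profile in the abstract slot at `R` fills the explicit slot at `R`** at the chosen width `σ₀ = h.width`
and fade `ε = h.fadeLen`. [folklore] -/
theorem LevelZeroDataAt.lineGermDataAt {R : TowerRates} {U : EuclideanSpace ℝ (Fin 3) → EuclideanSpace ℝ (Fin 3)}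
    {ρ : ℝ} (h : LevelZeroDataAt R U ρ) {c₄ : ℝ} (hc₄ : 0 < c₄) (hc₄' : c₄ ≤ 1) :
    LineGermDataAt R U ρ h.width (h.fadeLen hc₄) c₄ where
  smooth := h.smooth
  support := h.support
  divFree := h.divFree
  ceiling := h.ceiling
  floor := h.floor
  strain := h.strain
  core := h.core
  width_pos := h.width_spec.1
  line := h.width_spec.2
  fade_pos := (h.fadeLen_spec hc₄).1
  fade_le := (h.fadeLen_spec hc₄).2.1
  push_pos := hc₄
  push_le := hc₄'
  window := (h.fadeLen_spec hc₄).2.2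

namespace LineGermDataAt

variable {R : TowerRates} {U : EuclideanSpace ℝ (Fin 3) → EuclideanSpace ℝ (Fin 3)} {ρ σ₀ ε c₄ : ℝ}
  (d : LineGermDataAt R U ρ σ₀ ε c₄)
include d

/-- The profile has compact support and is confined to `B̄(0, ρ)` (explicit-slot form). [folklore] -/
theorem compact_confined : HasCompactSupport U ∧ (tsupport U ⊆ closedBall 0 ρ) ∧ 0 < ε :=
  ⟨(isCompact_closedBall (0 : EuclideanSpace ℝ (Fin 3)) ρ).of_isClosed_subset (isClosed_tsupport U) d.support,
    d.support, d.fade_pos⟩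

/-- **A shorter fade is still a certificate at `R`**: `LineGermDataAt R U ρ σ₀ ε' c₄` for every `0 < ε' ≤ ε`.
[folklore] -/
theorem restrictFade {ε' : ℝ} (hε' : 0 < ε') (hle : ε' ≤ ε) : LineGermDataAt R U ρ σ₀ ε' c₄ where
  smooth := d.smooth
  support := d.support
  divFree := d.divFree
  ceiling := d.ceiling
  floor := d.floor
  strain := d.strain
  core := d.core
  width_pos := d.width_pos
  line := d.line
  fade_pos := hε'
  fade_le := hle.trans d.fade_le
  push_pos := d.push_pos
  push_le := d.push_le
  window := fun t ht x => d.window t ⟨ht.1, ht.2.trans (by linarith)⟩ x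

/-- **The force's static facts**: jointly smooth, compact space-time support, confined to the ball, equal to
the residual for `t ≤ 1`, zero at the readout `t = 1`. [cite: FeffermanClay2006, (5) (6)] -/
theorem force_facts :
    ContDiff ℝ ∞ (uncurry (lineForce U σ₀ ε)) ∧ HasCompactSupport (uncurry (lineForce U σ₀ ε)) ∧
      (∀ t (x : EuclideanSpace ℝ (Fin 3)), ρ < ‖x‖ → lineForce U σ₀ ε t x = 0) ∧
      (∀ t, t ≤ 1 → ∀ x : EuclideanSpace ℝ (Fin 3),
        lineForce U σ₀ ε t x = germResid 1 U αhost (βhost σ₀) t x) ∧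
      ∀ x : EuclideanSpace ℝ (Fin 3), lineForce U σ₀ ε 1 x = 0 := by
  have hres : ∀ t, t ≤ 1 → ∀ x : EuclideanSpace ℝ (Fin 3),
      lineForce U σ₀ ε t x = germResid 1 U αhost (βhost σ₀) t x := fun t ht x =>
    germForce_eq_germResid d.fade_pos (by show t ≤ 1 + ε - ε; linarith) x
  refine ⟨contDiff_uncurry_germForce d.smooth d.compact_confined.1 contDiff_αhost (contDiff_βhost _),
    hasCompactSupport_germForce d.smooth d.compact_confined.1 d.fade_pos d.support
      (fun _ ht => αhost_of_nonpos ht) (fun _ ht => βhost_of_nonpos ht),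
    fun t x hx => germForce_eq_zero_of_norm_gt d.smooth d.compact_confined.1 d.support t hx, hres, fun x => ?_⟩
  rw [hres 1 le_rfl]
  exact germResid_eq_zero_of_matched αhost_one deriv_αhost_one (βhost_one _) (deriv_βhost_one d.width_pos.ne') x

/-- The force vanishes from `τ₁(R) = 1 + w₀(R)` on. [folklore] -/
theorem force_eq_zero_of_ge : ∀ t, Host.τfirstAt R ≤ t → ∀ x, lineForce U σ₀ ε t x = 0 := by
  intro t ht x
  have h1 : 1 + ε ≤ t := by rw [Host.τfirstAt_eq] at ht; linarith [d.fade_le]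
  exact germForce_eq_zero_of_ge d.fade_pos h1 x

/-- `‖force‖ ≤ c₄ Y₀(R)` on `[1, τ₁(R)]`. [folklore] -/
theorem norm_force_le :
    ∀ t ∈ Icc (1 : ℝ) (Host.τfirstAt R), ∀ x, ‖lineForce U σ₀ ε t x‖ ≤ c₄ * R.Y 0 :=
  fun _ ht x => norm_germForce_le_of_window d.fade_pos (mul_pos d.push_pos (R.Y_pos 0)).le d.window ht.1 x

/-- **The faded residual is `O(ε')` on the fade window, uniformly in the shorter fade `ε' ≤ ε`.** There is
`L ≥ 0` with `‖lineForce U σ₀ ε' t x‖ ≤ ε' L` for `t ∈ [1, 1 + ε']`, all `x`, all `0 < ε' ≤ ε` (mean value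
theorem on the matched residual over `[1, 1 + ε] × B̄(0, ρ)`). [folklore] -/
theorem exists_norm_lineForce_le_mul :
    ∃ L : ℝ, 0 ≤ L ∧ ∀ ε' : ℝ, 0 < ε' → ε' ≤ ε →
      ∀ t ∈ Icc (1 : ℝ) (1 + ε'), ∀ x, ‖lineForce U σ₀ ε' t x‖ ≤ ε' * L := by
  set g : ℝ × EuclideanSpace ℝ (Fin 3) → EuclideanSpace ℝ (Fin 3) :=
    uncurry (germResid 1 U αhost (βhost σ₀)) with hg
  have hgs : ContDiff ℝ ∞ g :=
    contDiff_uncurry_germResid d.smooth d.compact_confined.1 contDiff_αhost (contDiff_βhost _)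
  have hgd : ∀ z, DifferentiableAt ℝ g z := fun z => (hgs.differentiable (by simp)) z
  have hgc : Continuous (fderiv ℝ g) := hgs.continuous_fderiv (by simp)
  set K : Set (ℝ × EuclideanSpace ℝ (Fin 3)) :=
    Icc (1 : ℝ) (1 + ε) ×ˢ closedBall (0 : EuclideanSpace ℝ (Fin 3)) ρ with hK
  have hKc : IsCompact K := isCompact_Icc.prod (isCompact_closedBall _ _)
  have hKconv : Convex ℝ K := (convex_Icc _ _).prod (convex_closedBall _ _)
  obtain ⟨C, hC⟩ := hKc.exists_bound_of_continuousOn hgc.continuousOn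
  refine ⟨max C 0, le_max_right _ _, fun ε' hε' hle t ht x => ?_⟩
  have hres : ‖germResid 1 U αhost (βhost σ₀) t x‖ ≤ max C 0 * (t - 1) := by
    by_cases hx : ‖x‖ ≤ ρ
    · have hx' : x ∈ closedBall (0 : EuclideanSpace ℝ (Fin 3)) ρ := by
        rw [mem_closedBall, dist_zero_right]; exact hx
      have h1K : ((1 : ℝ), x) ∈ K := mk_mem_prod ⟨le_rfl, by linarith [d.fade_pos]⟩ hx'
      have htK : (t, x) ∈ K := mk_mem_prod ⟨ht.1, ht.2.trans (by linarith)⟩ hx'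
      have hmvt := hKconv.norm_image_sub_le_of_norm_fderiv_le (f := g) (C := max C 0) (fun z _ => hgd z)
        (fun z hz => (hC z hz).trans (le_max_left C 0)) h1K htK
      have h0 : g ((1 : ℝ), x) = 0 := by
        show germResid 1 U αhost (βhost σ₀) 1 x = 0
        exact germResid_eq_zero_of_matched αhost_one deriv_αhost_one (βhost_one _)
          (deriv_βhost_one d.width_pos.ne') x
      have hdist : ‖((t, x) : ℝ × EuclideanSpace ℝ (Fin 3)) - ((1 : ℝ), x)‖ = t - 1 := by
        rw [Prod.mk_sub_mk, sub_self, Prod.norm_mk, norm_zero, Real.norm_of_nonneg (by linarith [ht.1]),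
          max_eq_left (by linarith [ht.1])]
      rw [h0, sub_zero, hdist] at hmvt
      exact hmvt
    · rw [not_le] at hx
      rw [germResid_eq_zero_of_norm_gt d.smooth d.compact_confined.1 d.support t hx, norm_zero]
      exact mul_nonneg (le_max_right _ _) (by linarith [ht.1])
  calc ‖lineForce U σ₀ ε' t x‖ ≤ ‖germResid 1 U αhost (βhost σ₀) t x‖ := norm_germForce_le t x
    _ ≤ max C 0 * (t - 1) := hres
    _ ≤ max C 0 * ε' := mul_le_mul_of_nonneg_left (by linarith [ht.2]) (le_max_right _ _)
    _ = ε' * max C 0 := mul_comm _ _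

/-! ## §2 The explicit schedule at `R`, its stage, its slice-run door -/

/-- **THE EXPLICIT GERM SCHEDULE AT THE RATES `R`** `S*(U, ρ, σ₀, ε, c₄)` (box schedule at `R`, register
numerics `hR`). [cite: Palasek2026ElementaryModel, §3.3] -/
def schedule {c₃ r : ℝ} (hR : R.BoxNumerics c₃ r) : Schedule R :=
  Schedule.ofBoxAt R c₃ r hR.r_nonneg hR.r_lt_one hR.geo hR.clock (hR.sep 0) 0 (lineForce U σ₀ ε) ρ c₄
    d.push_le contDiff_const HasCompactSupport.zero d.force_facts.1 d.force_facts.2.1 d.force_eq_zero_of_ge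
    d.norm_force_le

section Schedule

variable {c₃ r : ℝ} (hR : R.BoxNumerics c₃ r)

/-- The explicit schedule at `R`: RIGID, QUIET, PINNED (`Λ = 8`, `θ = 6/5`); `τ 0 = 1`, `τ 1 = τ₁(R)`,
force / radius / `c₁` / `c₂`. [folklore] -/
theorem schedule_facts :
    (d.schedule hR).Rigid ∧ (d.schedule hR).Quiet ∧ (d.schedule hR).Pins 8 (6 / 5) ∧
      (d.schedule hR).τ 0 = 1 ∧ (d.schedule hR).τ 1 = Host.τfirstAt R ∧
      (d.schedule hR).f = lineForce U σ₀ ε ∧ (d.schedule hR).radius = ρ ∧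
      (d.schedule hR).c₁ = 1 ∧ (d.schedule hR).c₂ = 5 / 3 :=
  ⟨Schedule.ofBoxAt_rigid _ _ _ _ _ _ _ _ _ _ _ _, Schedule.ofBoxAt_quiet _ _ _ _ _ _ _ _ _ _ _ _,
    Schedule.ofBoxAt_pins _ _ _ _ _ _ _ _ _ _ _ _ hR.sep hR.window_le (fun _ _ => rfl) d.force_facts.2.2.1,
    Host.windowTimeAt_zero R, rfl, rfl, rfl, rfl, rfl⟩

/-- The line germ solves forced NS with the schedule's force on `[0, 1]`, has finite energy there, arrives
with `∂ₜu(τ₀) = V`, and obeys the GLOBAL ANCHOR `‖u(t)‖ < Y₀(R)` for `t < 1`, `≤ Y₀(R)` for `t ≤ 1`.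
[cite: FeffermanClay2006, (1) (2) (7)] -/
theorem germ_facts :
    IsClassicalNSSolutionOn (Icc 0 1) 1 (d.schedule hR).f (lineVel U σ₀) (linePres U σ₀) ∧
      (∃ C : ℝ≥0∞, C < ⊤ ∧ ∀ t ∈ Icc (0 : ℝ) 1, ∫⁻ x, ‖lineVel U σ₀ t x‖ₑ ^ 2 ≤ C) ∧
      (∀ x : EuclideanSpace ℝ (Fin 3), timeDerivWithin (Icc 0 1) (lineVel U σ₀) 1 x = accel 1 U x) ∧
      (∀ t : ℝ, t < 1 → ∀ x : EuclideanSpace ℝ (Fin 3), ‖lineVel U σ₀ t x‖ < R.Y 0) ∧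
      ∀ t : ℝ, t ≤ 1 → ∀ x : EuclideanSpace ℝ (Fin 3), ‖lineVel U σ₀ t x‖ ≤ R.Y 0 := by
  have hb := isClassicalNSSolutionOn_germ (ν := 1) (α := αhost) (β := βhost σ₀) d.smooth d.compact_confined.1
    contDiff_αhost (contDiff_βhost _) d.divFree one_pos
  refine ⟨⟨hb.smooth_velocity, hb.smooth_pressure, fun t ht x => ?_, hb.divFree⟩,
    energy_germ (ν := 1) d.smooth d.compact_confined.1 (fun t _ => abs_αhost_le_one t)
      (fun _ ht => abs_βhost_le d.width_pos ht.2), fun x => ?_,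
    fun t ht x => norm_germ_lt d.width_pos d.line ht x,
    fun t ht x => norm_germ_le d.width_pos d.ceiling d.line ht x⟩
  · have hf : (d.schedule hR).f t x = germResid 1 U αhost (βhost σ₀) t x := d.force_facts.2.2.2.1 t ht.2 x
    rw [hf]
    exact hb.momentum t ht x
  · rw [lineVel, timeDerivWithin_germ (contDiff_αhost.differentiable (by simp))
      ((contDiff_βhost _).differentiable (by simp)) one_pos ⟨zero_le_one, le_rfl⟩,
      deriv_αhost_one, deriv_βhost_one d.width_pos.ne', zero_smul, one_smul, zero_add]

/-- **THE LEVEL-`0` STAGE OF THE EXPLICIT SCHEDULE AT `R`** (velocity = the line germ).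
[cite: Palasek2026ElementaryModel, §3.3] -/
theorem stage : Nonempty (Stage 1 R (d.schedule hR) (Margins.routeG R) 0) := by
  obtain ⟨hrig, -, -, hτ0, -, -, hrad, hc₁, hc₂⟩ := d.schedule_facts hR
  obtain ⟨hcl1, hE1, -, hlt, hle⟩ := d.germ_facts hR
  have henergy : ∃ C : ℝ≥0∞, C < ⊤ ∧
      ∀ t ∈ Icc 0 ((d.schedule hR).τ 0), ∫⁻ x, ‖lineVel U σ₀ t x‖ₑ ^ 2 ≤ C := by rw [hτ0]; exact hE1
  have hcl : IsClassicalNSSolutionOn (Icc 0 ((d.schedule hR).τ 0)) 1 (d.schedule hR).f (lineVel U σ₀)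
      (linePres U σ₀) := by rw [hτ0]; exact hcl1
  refine ⟨{ u := lineVel U σ₀, p := linePres U σ₀, classical := hcl, initial := ?_,
            energy := henergy, floor := ?_, ceiling := ?_, quiet := ?_, margin := ?_ }⟩
  · rw [lineVel_zero]; rfl
  · intro j hj
    obtain rfl := Nat.le_zero.1 hj
    obtain ⟨x, hx, hfl⟩ := d.floor
    refine ⟨x, by rw [hrad]; exact hx, ?_⟩
    rw [hτ0, hc₁, one_mul, lineVel_one]
    exact hfl
  · intro j hj t ht x
    obtain rfl := Nat.le_zero.1 hj
    rw [hτ0] at ht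
    rw [hc₂]
    have := hle t ht.2 x
    have hY := R.Y_pos 0
    linarith
  · intro j hj
    exact absurd hj (by omega)
  · show (∀ j, j ≤ 0 → ∃ x, ‖x‖ ≤ (d.schedule hR).radius ∧
        (d.schedule hR).c₁ * R.A j ≤ ‖fderiv ℝ (lineVel U σ₀ ((d.schedule hR).τ j)) x‖) ∧
      ((d.schedule hR).AnchorGlobal (lineVel U σ₀) ∧
        ((d.schedule hR).Rigid ∧ CoreLedger R (d.schedule hR) 0 (lineVel U σ₀)))
    refine ⟨?_, ?_, hrig, ?_⟩
    · intro j hj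
      obtain rfl := Nat.le_zero.1 hj
      obtain ⟨x, hx, hst⟩ := d.strain
      refine ⟨x, by rw [hrad]; exact hx, ?_⟩
      rw [hτ0, hc₁, one_mul, lineVel_one]
      exact hst
    · intro t ht x
      rw [hτ0] at ht
      rw [hc₁, one_mul]
      exact hlt t ht.2 x
    · intro j hj
      obtain rfl := Nat.le_zero.1 hj
      obtain ⟨x, γ, hx, hγ, hcl', hball, hspeed, hcirc⟩ := d.core
      refine ⟨x, γ, by rw [hrad]; exact hx, hγ, hcl', hball, hspeed, ?_⟩
      rw [hτ0, hc₁, one_mul, lineVel_one]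
      exact hcirc

/-- Every level-`0` stage of the explicit schedule at `R` has slice `u(τ₀) = U`. [cite: Sohr2001, Ch. V Thm. 1.5.1] -/
theorem stage_slice (s₀ : Stage 1 R (d.schedule hR) (Margins.routeG R) 0) : s₀.u 1 = U := by
  obtain ⟨-, -, -, hτ0, -⟩ := d.schedule_facts hR
  obtain ⟨hcl1, hE1, -⟩ := d.germ_facts hR
  have h0 : lineVel U σ₀ 0 = (d.schedule hR).u₀ := by rw [lineVel_zero]; rfl
  have key := s₀.velocity_eq_of_classical one_pos (T' := 1) (by rw [hτ0]) hcl1 h0 hE1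
  rw [hτ0] at key
  rw [← key 1 ⟨zero_le_one, le_rfl⟩, lineVel_one]

/-- **THE SLICE-RUN DOOR OF THE EXPLICIT SLOT AT `R`.** `d : LineGermDataAt R U ρ σ₀ ε c₄` at a
register-admissible `R` and ONE classical finite-energy solution `(v, q)` of Navier–Stokes at unit viscosity on
`[1, τ₁(R)]` forced by `lineForce U σ₀ ε`, from `v 1 = U`, below `(5/3) Y₁(R)`, with the three level-`1` floors
at `τ₁(R)` in `B̄(0, ρ)` ⟹ `EpisodeBaseGAt R`. [cite: Palasek2026ElementaryModel, §4] [cite: Sohr2001, Ch. V Thm. 1.5.1] -/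
theorem episodeBaseGAt_of_sliceRun {c₃' r' : ℝ} (hR : R.BoxNumerics c₃' r')
    {v : ℝ → EuclideanSpace ℝ (Fin 3) → EuclideanSpace ℝ (Fin 3)} {q : ℝ → EuclideanSpace ℝ (Fin 3) → ℝ}
    (hcl : IsClassicalNSSolutionOn (Icc 1 (Host.τfirstAt R)) 1 (lineForce U σ₀ ε) v q) (h1 : v 1 = U)
    (henergy : ∃ C : ℝ≥0∞, C < ⊤ ∧ ∀ t ∈ Icc (1 : ℝ) (Host.τfirstAt R), ∫⁻ x, ‖v t x‖ₑ ^ 2 ≤ C)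
    (hceil : ∀ t ∈ Icc (1 : ℝ) (Host.τfirstAt R), ∀ x, ‖v t x‖ ≤ 5 / 3 * R.Y 1)
    (hfloor : ∃ x, ‖x‖ ≤ ρ ∧ R.Y 1 ≤ ‖v (Host.τfirstAt R) x‖)
    (hstrain : ∃ x, ‖x‖ ≤ ρ ∧ R.A 1 ≤ ‖fderiv ℝ (v (Host.τfirstAt R)) x‖)
    (hcore : ∃ (x : EuclideanSpace ℝ (Fin 3)) (γ : ℝ → EuclideanSpace ℝ (Fin 3)),
      ‖x‖ ≤ ρ ∧ ContDiff ℝ 1 γ ∧ γ 0 = γ 1 ∧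
      (∀ s ∈ Icc (0 : ℝ) 1, γ s ∈ closedBall x (1 / R.N 1)) ∧
      (∀ s ∈ Icc (0 : ℝ) 1, ‖deriv γ s‖ ≤ 8 * Real.pi / R.N 1) ∧
      R.N 1 ^ (R.β - 2) ≤ circulation (v (Host.τfirstAt R)) γ) :
    EpisodeBaseGAt R := by
  obtain ⟨s₀⟩ := d.stage hR
  obtain ⟨hrig, hqu, hpins, hτ0, hτ1, hf, hrad, hc₁, hc₂⟩ := d.schedule_facts hR
  set S := d.schedule hR with hS
  have hslice : s₀.u 1 = U := d.stage_slice hR s₀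
  have hext : ∃ s' : Stage 1 R S (Margins.routeG R) (0 + 1), s₀.Extends s' := by
    refine s₀.exists_extends_of_sliceRun one_pos (v := v) (q := q) ?_ ?_ ?_ ?_ ?_ ?_ ?_
    · show IsClassicalNSSolutionOn (Icc (S.τ 0) (S.τ (0 + 1))) 1 S.f v q
      rw [hτ0, zero_add, hτ1, hf]; exact hcl
    · show v (S.τ 0) = s₀.u (S.τ 0)
      rw [hτ0, h1, hslice]
    · show ∃ C : ℝ≥0∞, C < ⊤ ∧ ∀ t ∈ Icc (S.τ 0) (S.τ (0 + 1)), ∫⁻ x, ‖v t x‖ₑ ^ 2 ≤ C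
      rw [hτ0, zero_add, hτ1]; exact henergy
    · show ∀ t ∈ Icc (S.τ 0) (S.τ (0 + 1)), ∀ x, ‖v t x‖ ≤ S.c₂ * R.Y (0 + 1)
      rw [hτ0, zero_add, hτ1, hc₂]; exact hceil
    · show ∃ x, ‖x‖ ≤ S.radius ∧ S.c₁ * R.Y (0 + 1) ≤ ‖v (S.τ (0 + 1)) x‖
      rw [zero_add, hτ1, hrad, hc₁, one_mul]; exact hfloor
    · show ∃ x, ‖x‖ ≤ S.radius ∧ S.c₁ * R.A (0 + 1) ≤ ‖fderiv ℝ (v (S.τ (0 + 1))) x‖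
      rw [zero_add, hτ1, hrad, hc₁, one_mul]; exact hstrain
    · show ∃ (x : EuclideanSpace ℝ (Fin 3)) (γ : ℝ → EuclideanSpace ℝ (Fin 3)),
        ‖x‖ ≤ S.radius ∧ ContDiff ℝ 1 γ ∧ γ 0 = γ 1 ∧
        (∀ σ ∈ Icc (0 : ℝ) 1, γ σ ∈ closedBall x (1 / R.N (0 + 1))) ∧
        (∀ σ ∈ Icc (0 : ℝ) 1, ‖deriv γ σ‖ ≤ 8 * Real.pi / R.N (0 + 1)) ∧
        S.c₁ * R.N (0 + 1) ^ (R.β - 2) ≤ circulation (v (S.τ (0 + 1))) γ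
      rw [zero_add, hτ1, hrad, hc₁, one_mul]; exact hcore
  obtain ⟨s₁, -⟩ := hext
  exact ⟨S, hpins, hrig, hqu, ⟨s₁⟩⟩

end Schedule

end LineGermDataAt

end Summit.NavierStokesRegularity.FluidComputer.PalasekTowerClayBridge.Germ

end
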